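import Literature.NumberTheory.EllipticCurves.PadicSeriesEvaluation
import HarnessLib

/-!
# The identity theorem for `p`-adically integral power series (proofs only)

Trunk T-NT-EC (Literature/NumberTheory/EllipticCurves); complement to
`PadicSeriesEvaluation.lean`. An integral series `f ∈ ℤ_p⟦X⟧ ⊂ ℚ_p⟦X⟧` whose values
`f(t) = padicEval f t` vanish at all points of the open unit disc — in fact at the points `pᵏ`,
`k ≥ 1`, suffices — is ZERO (`eq_zero_of_padicEval_pow_eq_zero`, `eq_zero_of_padicEval_eq_zero`):
if `n₀` is the order of `f` then `f = X^{n₀}·g` with `g(0) ≠ 0`, `g(t) = 0` for the same `t`, and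
`‖g(t) - g(0)‖ ≤ ‖t‖` forces `‖g(0)‖ ≤ p⁻ᵏ` for all `k`. This is the density principle by which
identities of formal group laws (e.g. associativity of `WeierstrassCurve.formalGroupLaw`) can be
read off from identities at points (`WeierstrassCurve.formalGroupLaw_padicEval`).

## References

* Standard (`p`-adic Weierstrass preparation / Strassmann's theorem give much more); e.g.
  F. Q. Gouvêa, *`p`-adic Numbers*, §6.2. Stated here as folklore.
-/

noncomputable section

open PowerSeries

namespace Literature.NumberTheory.EllipticCurves

variable {p : ℕ} [Fact p.Prime]

/-- Shifting an integral series down by its first `n₀` (vanishing) coefficients: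
`f = X^{n₀} · g` with `g = Σ f_{n+n₀} Xⁿ`. [folklore] -/
theorem eq_X_pow_mul_shift (f : ℚ_[p]⟦X⟧) (n₀ : ℕ) (h : ∀ n < n₀, coeff n f = 0) :
    f = X ^ n₀ * PowerSeries.mk fun n => coeff (n + n₀) f := by
  ext n
  rw [coeff_X_pow_mul']
  split_ifs with hn
  · rw [coeff_mk, Nat.sub_add_cancel hn]
  · exact h n (not_le.mp hn)

/-- The shifted series is integral. [folklore] -/
theorem isPadicInt_shift {f : ℚ_[p]⟦X⟧} (hf : IsPadicInt f) (n₀ : ℕ) :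
    IsPadicInt (PowerSeries.mk fun n => coeff (n + n₀) f : ℚ_[p]⟦X⟧) := by
  rw [isPadicInt_iff_coeff] at hf ⊢
  intro n; rw [coeff_mk]; exact hf _

/-- **Continuity at the centre**: `‖g(t) - g(0)‖ ≤ ‖t‖` for `g` integral, `‖t‖ < 1`. [folklore] -/
theorem norm_padicEval_sub_constantCoeff_le {g : ℚ_[p]⟦X⟧} (hg : IsPadicInt g) {t : ℚ_[p]}
    (ht : ‖t‖ < 1) : ‖padicEval g t - constantCoeff g‖ ≤ ‖t‖ := by
  have hc : ‖constantCoeff g‖ ≤ 1 := by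
    rw [← coeff_zero_eq_constantCoeff_apply]; exact isPadicInt_iff_coeff.mp hg 0
  have hC : IsPadicInt (PowerSeries.C (constantCoeff g) : ℚ_[p]⟦X⟧) :=
    IsPadicInt.C (σ := Unit) hc
  have h0 : constantCoeff (g - PowerSeries.C (constantCoeff g)) = 0 := by simp
  have := norm_padicEval_le (hg.sub hC) h0 ht
  rwa [padicEval_sub hg hC ht, padicEval_C] at this

/-- The powers `pᵏ`, `k ≥ 1`, lie in the open unit disc and have norm `p⁻ᵏ → 0`. [folklore] -/
theorem norm_natCast_pow (k : ℕ) : ‖((p : ℚ_[p]) ^ k)‖ = ((p : ℝ) ^ k)⁻¹ := by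
  rw [norm_pow, Padic.norm_p, inv_pow]

/-- **Identity theorem (values at `pᵏ`)**: an integral `f ∈ ℚ_p⟦X⟧` with `f(pᵏ) = 0` for all
`k ≥ 1` is zero. [folklore] -/
theorem eq_zero_of_padicEval_pow_eq_zero {f : ℚ_[p]⟦X⟧} (hf : IsPadicInt f)
    (h : ∀ k : ℕ, 1 ≤ k → padicEval f ((p : ℚ_[p]) ^ k) = 0) : f = 0 := by
  classical
  by_contra hne
  have hex : ∃ n, coeff n f ≠ 0 := by
    by_contra hall
    push Not at hall
    exact hne (PowerSeries.ext fun n => by rw [hall n, map_zero])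
  set n₀ := Nat.find hex with hn₀
  have hmin : ∀ n < n₀, coeff n f = 0 := fun n hn => by
    have := Nat.find_min hex (hn₀ ▸ hn); push Not at this; exact this
  have hlead : coeff n₀ f ≠ 0 := hn₀ ▸ Nat.find_spec hex
  set g : ℚ_[p]⟦X⟧ := PowerSeries.mk fun n => coeff (n + n₀) f with hgdef
  have hfg : f = X ^ n₀ * g := eq_X_pow_mul_shift f n₀ hmin
  have hg : IsPadicInt g := isPadicInt_shift hf n₀
  have hg0 : constantCoeff g = coeff n₀ f := by
    rw [← coeff_zero_eq_constantCoeff_apply, hgdef, coeff_mk, zero_add]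
  have hp1 : (1 : ℝ) < p := by exact_mod_cast (Fact.out : p.Prime).one_lt
  -- `‖g(0)‖ ≤ p⁻ᵏ` for every `k ≥ 1`
  have hbound : ∀ k : ℕ, 1 ≤ k → ‖coeff n₀ f‖ ≤ ((p : ℝ) ^ k)⁻¹ := by
    intro k hk
    have htk : ‖((p : ℚ_[p]) ^ k)‖ < 1 := by
      rw [norm_natCast_pow]; exact inv_lt_one_of_one_lt₀ (one_lt_pow₀ hp1 (by omega))
    have htk0 : ((p : ℚ_[p]) ^ k) ≠ 0 :=
      pow_ne_zero _ (Nat.cast_ne_zero.mpr (Fact.out : p.Prime).ne_zero)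
    have hval : padicEval g ((p : ℚ_[p]) ^ k) = 0 := by
      have := h k hk
      rw [hfg, padicEval_mul (IsPadicInt.powerSeries_X.pow n₀) hg htk,
        padicEval_pow IsPadicInt.powerSeries_X htk, padicEval_X, mul_eq_zero] at this
      exact this.resolve_left (pow_ne_zero _ htk0)
    have := norm_padicEval_sub_constantCoeff_le hg htk
    rwa [hval, zero_sub, norm_neg, hg0, norm_natCast_pow] at this
  -- hence `g(0) = 0`
  apply hlead
  rw [← norm_eq_zero]
  refine le_antisymm ?_ (norm_nonneg _)
  refine le_of_forall_pos_le_add fun ε hε => ?_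
  rw [zero_add]
  obtain ⟨k, hk⟩ := exists_pow_lt_of_lt_one hε (inv_lt_one_of_one_lt₀ hp1)
  refine (hbound (k + 1) (by omega)).trans ?_
  rw [← inv_pow]
  exact ((pow_le_pow_of_le_one (by positivity) (inv_le_one_of_one_le₀ hp1.le)
    (Nat.le_succ k)).trans hk.le)

/-- **Identity theorem (open unit disc)**: an integral `f ∈ ℚ_p⟦X⟧` vanishing at every point of
the open unit disc is zero. [folklore] -/
theorem eq_zero_of_padicEval_eq_zero {f : ℚ_[p]⟦X⟧} (hf : IsPadicInt f)
    (h : ∀ t : ℚ_[p], ‖t‖ < 1 → padicEval f t = 0) : f = 0 :=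
  eq_zero_of_padicEval_pow_eq_zero hf fun k hk => h _ (by
    rw [norm_natCast_pow]
    exact inv_lt_one_of_one_lt₀ (one_lt_pow₀ (by exact_mod_cast (Fact.out : p.Prime).one_lt)
      (by omega)))

/-- **Equality from equal values**: two integral series agreeing on the open unit disc are equal.
[folklore] -/
theorem eq_of_padicEval_eq {f g : ℚ_[p]⟦X⟧} (hf : IsPadicInt f) (hg : IsPadicInt g)
    (h : ∀ t : ℚ_[p], ‖t‖ < 1 → padicEval f t = padicEval g t) : f = g := by
  rw [← sub_eq_zero]
  exact eq_zero_of_padicEval_eq_zero (hf.sub hg) fun t ht => by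
    rw [padicEval_sub hf hg ht, h t ht, sub_self]

end Literature.NumberTheory.EllipticCurves
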